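import Literature.NumberTheory.GaloisRepresentations.SuperellipticTwistedFixedPlaces
import HarnessLib

/-!
# The places of `L(C_f)`, `C_f : y^p = f(x)`, as the points `(a, b)` of the affine curve plus `∞`

Topic `Literature/NumberTheory/GaloisRepresentations` (continues `SuperellipticTorsionRepProofs`,
`SuperellipticLambdaTorsionCoprime`, `SuperellipticPicGaloisModule`, `SuperellipticTwistedFixedPlaces`).  Let `L ⊇ K`
be algebraically closed containing a primitive `p`-th root of unity `ζ₀` (`p` prime, so `p ≠ char L`), `f ∈ K[X]`
separable, `L(C_f) = L(x)[y]/(y^p - f)` (`SuperellipticFunctionField`).  The tree describes the places of `L(C_f)/L`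
fibre by fibre over `L(x)` (`rootPlace α = T_α` above a root, `fibre_spec` / labels `y ≡ c (mod Q)` above a non-root,
`inftyPlace` above `∞`); this file packages that description as the classical dictionary
"places = points of the smooth projective model":

* `pointPlace K L p f a b` — **the place `Q_{(a,b)}` of the affine point `(a, b)`, `b^p = f(a)`**: the unique place
  above `x = a` at which `y ≡ b` (`pointPlace_spec`, `eq_pointPlace`, existence by a deck transformation of any place
  of the fibre, uniqueness by uniqueness of labels `label_unique` and simple transitivity of the deck group);
  `pointPlace_zero_eq_rootPlace` (`Q_{(α,0)} = T_α`), `pointPlace_inj`, `pointPlace_ne_inftyPlace`;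
* `exists_eq_pointPlace`, **`eq_inftyPlace_or_exists_eq_pointPlace`** — every place is `∞_C` (`p ∤ deg f`) or some
  `Q_{(a,b)}` (Stichtenoth Prop. 3.7.3 / Thm. 3.7.1 for the Kummer extension `L(C_f)/L(x)`);
* orders and congruences at `Q_{(a,b)}`: `ord_pointPlace_genX_sub_of_ne`, `ord_pointPlace_genX_sub_of_eval_ne_zero`
  (`v(x - a) = 1` at a non-root), `aeval_genX_mem_pointPlace`, `genY_mem_pointPlace`,
  `valuation_pointPlace_genX_sub_lt_one`, `valuation_pointPlace_genY_sub_lt_one` (`x ≡ a`, `y ≡ b`);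
* the actions: **`smul_pointPlace`** (`σ Q_{(a,b)} = Q_{(σa,σb)}` for automorphisms of `L/K`) and
  **`deck_smul_pointPlace`** (`ζ Q_{(a,b)} = Q_{(a,ζ⁻¹b)}` for `y ↦ ζ y`).

Everything is proved; the only `def` is `pointPlace` (junk value `rootPlace a` when no such place exists, which does
not happen for `b^p = f(a)` over `L` as above).  Used by the reduction map of `Pic(C_f)` modulo a prime
(`SuperellipticReduction`).

## References

* H. Stichtenoth, *Algebraic Function Fields and Codes*, 2nd ed., GTM 254 (2009), Lemma 3.5.2, Thm. 3.7.1,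
  Prop. 3.7.3. [Stichtenoth2009]
* E. F. Schaefer, *Computing a Selmer group of a Jacobian using functions on the curve*, Math. Ann. 310 (1998), §3. [Schaefer1998]
-/

noncomputable section

open Polynomial
open scoped Classical

namespace Literature.NumberTheory.GaloisRepresentations

open Literature.NumberTheory.DiophantineGeometry Literature.NumberTheory.DiophantineGeometry.AlgFunctionField

universe u v w

namespace SuperellipticFunctionField

variable {K : Type u} [Field K] {L : Type v} [Field L] [Algebra K L] {p : ℕ} {f : K[X]}
variable [Fact (Irreducible (superellipticPoly K L p f))]

/-! ### The place of an affine point -/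

variable (K L p f) in
/-- **The place `Q_{(a,b)}` of the affine point `(a, b)` of `C_f : y^p = f(x)`**: the place above `x = a` at which
`y ≡ b` — for `b^p = f(a)` over an algebraically closed `L ∋ ζ_p` it exists and is unique (`pointPlace_spec`,
`eq_pointPlace`); junk value `rootPlace a` otherwise.  For a root `α` of `f`, `Q_{(α,0)} = T_α` (`pointPlace_zero_eq_rootPlace`).
[cite: Stichtenoth2009, Prop. 3.7.3] -/
def pointPlace (a b : L) : PlaceOver L (SuperellipticFunctionField K L p f) :=
  if h : ∃ Q : PlaceOver L (SuperellipticFunctionField K L p f),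
      Q.restrict (K := L) (F := RatFunc L) = placeXSubC a ∧ Q.valuation (genY K L p f - algebraMap L _ b) < 1
  then h.choose else rootPlace K L p f a

variable [hp : Fact p.Prime]

/-- Above a root `α`: `y ≡ 0 (mod T_α)`. [cite: Schaefer1998, §3] -/
theorem valuation_rootPlace_genY_lt_one (hsep : f.Separable) {α : L} (hα : (f.map (algebraMap K L)).IsRoot α) :
    (rootPlace K L p f α).valuation (genY K L p f - algebraMap L _ 0) < 1 := by
  rw [map_zero, sub_zero, PlaceOver.valuation_lt_one_iff_ord_pos _ (genY_ne_zero hp.out.ne_zero hsep.ne_zero),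
    ord_rootPlace_genY hsep hα]
  exact zero_lt_one

/-- **Existence of the place of a point**: for `b^p = f(a)` (over an algebraically closed `L ∋ ζ_p`, `f` separable)
there is a place above `x = a` with `y ≡ b`.  Above a non-root: take any place, read off its label `c` and apply the
deck transformation `ζ = c/b`; above a root: `b = 0` and `T_a` does it. [cite: Stichtenoth2009, Prop. 3.7.3] -/
theorem exists_restrict_eq_and_valuation_lt_one [IsAlgClosed L] {ζ₀ : L} (hζ₀ : IsPrimitiveRoot ζ₀ p)
    (hsep : f.Separable) {a b : L} (hb : b ^ p = (f.map (algebraMap K L)).eval a) :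
    ∃ Q : PlaceOver L (SuperellipticFunctionField K L p f),
      Q.restrict (K := L) (F := RatFunc L) = placeXSubC a ∧ Q.valuation (genY K L p f - algebraMap L _ b) < 1 := by
  by_cases hβ : (f.map (algebraMap K L)).eval a = 0
  · have hb0 : b = 0 := by
      rw [hβ] at hb
      exact eq_zero_of_pow_eq_zero hb
    subst hb0
    exact ⟨rootPlace K L p f a, restrict_rootPlace a, valuation_rootPlace_genY_lt_one hsep hβ⟩
  · obtain ⟨Q₀, hQ₀⟩ := PlaceOver.exists_restrict_eq' (K := L) (F := RatFunc L)
      (F' := SuperellipticFunctionField K L p f) (placeXSubC a)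
    obtain ⟨huQ, hlt⟩ := genY_mem_and_valuation_lt_one_of_eval_ne_zero hβ hQ₀
    obtain ⟨c, hcp, hlab⟩ := exists_label hζ₀ huQ hlt
    have hb0 : b ≠ 0 := by rintro rfl; rw [zero_pow hp.out.ne_zero] at hb; exact hβ hb.symm
    have hc0 : c ≠ 0 := by rintro rfl; rw [zero_pow hp.out.ne_zero] at hcp; exact hβ hcp.symm
    have hη : (c * b⁻¹) ^ p = 1 := by
      rw [mul_pow, inv_pow, hcp, hb, mul_inv_cancel₀ hβ]
    refine ⟨CyclicCoverDeck.ofRoot hη • Q₀, by rw [restrict_deck_smul, hQ₀], ?_⟩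
    have h := valuation_deck_smul_sub_lt_one deck_smul_genY hlab (CyclicCoverDeck.ofRoot hη)
    have heq : (c * b⁻¹)⁻¹ * c = b := by field_simp
    rwa [CyclicCoverDeck.val_ofRoot, heq] at h

/-- **The place of a point lies above `x = a` and has label `b`** (`b^p = f(a)`). [cite: Stichtenoth2009, Prop. 3.7.3] -/
theorem pointPlace_spec [IsAlgClosed L] {ζ₀ : L} (hζ₀ : IsPrimitiveRoot ζ₀ p) (hsep : f.Separable) {a b : L}
    (hb : b ^ p = (f.map (algebraMap K L)).eval a) :
    (pointPlace K L p f a b).restrict (K := L) (F := RatFunc L) = placeXSubC a ∧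
      (pointPlace K L p f a b).valuation (genY K L p f - algebraMap L _ b) < 1 := by
  have h := exists_restrict_eq_and_valuation_lt_one hζ₀ hsep hb
  rw [pointPlace, dif_pos h]
  exact h.choose_spec

/-- `Q_{(a,b)}` lies above `P_a`. [folklore] -/
theorem restrict_pointPlace [IsAlgClosed L] {ζ₀ : L} (hζ₀ : IsPrimitiveRoot ζ₀ p) (hsep : f.Separable) {a b : L}
    (hb : b ^ p = (f.map (algebraMap K L)).eval a) :
    (pointPlace K L p f a b).restrict (K := L) (F := RatFunc L) = placeXSubC a :=
  (pointPlace_spec hζ₀ hsep hb).1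

/-- `y ≡ b (mod Q_{(a,b)})`. [folklore] -/
theorem valuation_pointPlace_genY_sub_lt_one [IsAlgClosed L] {ζ₀ : L} (hζ₀ : IsPrimitiveRoot ζ₀ p) (hsep : f.Separable)
    {a b : L} (hb : b ^ p = (f.map (algebraMap K L)).eval a) :
    (pointPlace K L p f a b).valuation (genY K L p f - algebraMap L _ b) < 1 :=
  (pointPlace_spec hζ₀ hsep hb).2

/-- **Uniqueness of the place with a given point**: a place above `x = a` with `y ≡ b` is `Q_{(a,b)}`.  Above a
non-root the deck group is transitive and shifts labels by `ζ⁻¹`, and labels are unique; above a root there is one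
place. [cite: Stichtenoth2009, Thm. 3.7.1] -/
theorem eq_of_restrict_eq_of_valuation_lt_one [IsAlgClosed L] {ζ₀ : L} (hζ₀ : IsPrimitiveRoot ζ₀ p) (hsep : f.Separable)
    {a b : L} (hb : b ^ p = (f.map (algebraMap K L)).eval a) {Q Q' : PlaceOver L (SuperellipticFunctionField K L p f)}
    (hQ : Q.restrict (K := L) (F := RatFunc L) = placeXSubC a) (hQb : Q.valuation (genY K L p f - algebraMap L _ b) < 1)
    (hQ' : Q'.restrict (K := L) (F := RatFunc L) = placeXSubC a) (hQ'b : Q'.valuation (genY K L p f - algebraMap L _ b) < 1) :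
    Q = Q' := by
  by_cases hβ : (f.map (algebraMap K L)).eval a = 0
  · rw [eq_rootPlace_of_restrict_eq hsep hβ hQ, eq_rootPlace_of_restrict_eq hsep hβ hQ']
  · have hb0 : b ≠ 0 := by rintro rfl; rw [zero_pow hp.out.ne_zero] at hb; exact hβ hb.symm
    obtain ⟨ζ, hζ⟩ := exists_deck_smul_eq_of_eval_ne_zero hζ₀ hβ hQ hQ'
    have h1 : (ζ • Q).valuation (genY K L p f - algebraMap L _ (ζ.val⁻¹ * b)) < 1 :=
      valuation_deck_smul_sub_lt_one deck_smul_genY hQb ζ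
    rw [hζ] at h1
    have heq : ζ.val⁻¹ * b = b := label_unique h1 hQ'b
    have hval : ζ.val = 1 := by
      have h4 : ζ.val⁻¹ = 1 := mul_right_cancel₀ hb0 (heq.trans (one_mul b).symm)
      rw [← inv_inv ζ.val, h4, inv_one]
    have hζ1 : ζ = 1 := CyclicCoverDeck.val_injective (by rw [hval, CyclicCoverDeck.val_one])
    rw [← hζ, hζ1, one_smul]

/-- A place above `x = a` with `y ≡ b` is `Q_{(a,b)}`. [cite: Stichtenoth2009, Thm. 3.7.1] -/
theorem eq_pointPlace [IsAlgClosed L] {ζ₀ : L} (hζ₀ : IsPrimitiveRoot ζ₀ p) (hsep : f.Separable)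
    {a b : L} (hb : b ^ p = (f.map (algebraMap K L)).eval a) {Q : PlaceOver L (SuperellipticFunctionField K L p f)}
    (hQ : Q.restrict (K := L) (F := RatFunc L) = placeXSubC a) (hQb : Q.valuation (genY K L p f - algebraMap L _ b) < 1) :
    Q = pointPlace K L p f a b :=
  eq_of_restrict_eq_of_valuation_lt_one hζ₀ hsep hb hQ hQb (restrict_pointPlace hζ₀ hsep hb)
    (valuation_pointPlace_genY_sub_lt_one hζ₀ hsep hb)

/-- **`Q_{(α,0)} = T_α`** for a root `α` of `f`. [cite: Schaefer1998, §3] -/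
theorem pointPlace_zero_eq_rootPlace [IsAlgClosed L] {ζ₀ : L} (hζ₀ : IsPrimitiveRoot ζ₀ p) (hsep : f.Separable)
    {α : L} (hα : (f.map (algebraMap K L)).IsRoot α) :
    pointPlace K L p f α 0 = rootPlace K L p f α :=
  (eq_pointPlace hζ₀ hsep (by rw [zero_pow hp.out.ne_zero]; exact hα.symm) (restrict_rootPlace α)
    (valuation_rootPlace_genY_lt_one hsep hα)).symm

/-- **Every place above a finite place is the place of a point**: `Q = Q_{(a,b)}` with `b = y(Q)`, `b^p = f(a)`.
[cite: Stichtenoth2009, Prop. 3.7.3] -/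
theorem exists_eq_pointPlace [IsAlgClosed L] {ζ₀ : L} (hζ₀ : IsPrimitiveRoot ζ₀ p) (hsep : f.Separable)
    {Q : PlaceOver L (SuperellipticFunctionField K L p f)} {a : L}
    (hQ : Q.restrict (K := L) (F := RatFunc L) = placeXSubC a) :
    ∃ b : L, b ^ p = (f.map (algebraMap K L)).eval a ∧ Q = pointPlace K L p f a b := by
  by_cases hβ : (f.map (algebraMap K L)).eval a = 0
  · refine ⟨0, by rw [zero_pow hp.out.ne_zero]; exact hβ.symm, ?_⟩
    rw [eq_rootPlace_of_restrict_eq hsep hβ hQ, pointPlace_zero_eq_rootPlace hζ₀ hsep hβ]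
  · obtain ⟨huQ, hlt⟩ := genY_mem_and_valuation_lt_one_of_eval_ne_zero hβ hQ
    obtain ⟨c, hcp, hlab⟩ := exists_label hζ₀ huQ hlt
    exact ⟨c, hcp, eq_pointPlace hζ₀ hsep hcp hQ hlab⟩

/-- **Classification of the places of `L(C_f)`** (`L ∋ ζ_p` algebraically closed, `f` separable, `p ∤ deg f`): every
place is `∞_C` or the place `Q_{(a,b)}` of an affine point `(a, b)`, `b^p = f(a)`. [cite: Stichtenoth2009, Prop. 3.7.3] -/
theorem eq_inftyPlace_or_exists_eq_pointPlace [IsAlgClosed L] {ζ₀ : L} (hζ₀ : IsPrimitiveRoot ζ₀ p) (hsep : f.Separable)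
    (hndvd : ¬ p ∣ f.natDegree) (Q : PlaceOver L (SuperellipticFunctionField K L p f)) :
    Q = inftyPlace K L p f ∨ ∃ a b : L, b ^ p = (f.map (algebraMap K L)).eval a ∧ Q = pointPlace K L p f a b := by
  rcases eq_ratFuncInftyPlace_or_exists_eq_placeXSubC L (Q.restrict (K := L) (F := RatFunc L)) with h | ⟨a, ha⟩
  · exact Or.inl (eq_inftyPlace_of_restrict_eq hndvd h)
  · obtain ⟨b, hb, hQ⟩ := exists_eq_pointPlace hζ₀ hsep ha
    exact Or.inr ⟨a, b, hb, hQ⟩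

/-- `Q_{(a,b)} ≠ ∞_C`. [folklore] -/
theorem pointPlace_ne_inftyPlace [IsAlgClosed L] {ζ₀ : L} (hζ₀ : IsPrimitiveRoot ζ₀ p) (hsep : f.Separable)
    {a b : L} (hb : b ^ p = (f.map (algebraMap K L)).eval a) : pointPlace K L p f a b ≠ inftyPlace K L p f :=
  ne_inftyPlace_of_restrict_eq_placeXSubC (restrict_pointPlace hζ₀ hsep hb)

/-- **The point of a place is unique**: `Q_{(a,b)} = Q_{(a',b')}` forces `(a, b) = (a', b')`. [folklore] -/
theorem pointPlace_inj [IsAlgClosed L] {ζ₀ : L} (hζ₀ : IsPrimitiveRoot ζ₀ p) (hsep : f.Separable)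
    {a b a' b' : L} (hb : b ^ p = (f.map (algebraMap K L)).eval a) (hb' : b' ^ p = (f.map (algebraMap K L)).eval a')
    (h : pointPlace K L p f a b = pointPlace K L p f a' b') : a = a' ∧ b = b' := by
  have ha : a = a' := by
    have h1 := restrict_pointPlace hζ₀ hsep hb
    rw [h, restrict_pointPlace hζ₀ hsep hb'] at h1
    exact (placeXSubC_injective h1).symm
  subst ha
  refine ⟨rfl, label_unique (valuation_pointPlace_genY_sub_lt_one hζ₀ hsep hb) ?_⟩
  rw [h]
  exact valuation_pointPlace_genY_sub_lt_one hζ₀ hsep hb'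

/-! ### Orders of `x - a'` at the place of a point -/

/-- `v_{Q_{(a,b)}}(x - a') = 0` for `a' ≠ a`. [folklore] -/
theorem ord_pointPlace_genX_sub_of_ne [IsAlgClosed L] {ζ₀ : L} (hζ₀ : IsPrimitiveRoot ζ₀ p) (hsep : f.Separable)
    {a b a' : L} (hb : b ^ p = (f.map (algebraMap K L)).eval a) (ha' : a ≠ a') :
    (pointPlace K L p f a b).ord (genX K L p f - algebraMap L _ a') = 0 :=
  ord_genX_sub_eq_zero_of_restrict_eq (restrict_pointPlace hζ₀ hsep hb) ha'

/-- **`v_{Q_{(a,b)}}(x - a) = 1` at a non-root** (`f(a) ≠ 0`: the fibre is unramified). [cite: Stichtenoth2009, Prop. 3.7.3] -/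
theorem ord_pointPlace_genX_sub_of_eval_ne_zero [IsAlgClosed L] {ζ₀ : L} (hζ₀ : IsPrimitiveRoot ζ₀ p) (hsep : f.Separable)
    {a b : L} (hb : b ^ p = (f.map (algebraMap K L)).eval a) (hβ : (f.map (algebraMap K L)).eval a ≠ 0) :
    (pointPlace K L p f a b).ord (genX K L p f - algebraMap L _ a) = 1 := by
  rw [ord_genX_sub_algebraMap, restrict_pointPlace hζ₀ hsep hb, ord_placeXSubC_X_sub_C, mul_one,
    ramificationIdx_eq_one_of_eval_ne_zero hζ₀ hβ (restrict_pointPlace hζ₀ hsep hb)]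

/-- `x ∈ O_{Q_{(a,b)}}` and `g(x) ∈ O_{Q_{(a,b)}}` for every polynomial `g`. [folklore] -/
theorem aeval_genX_mem_pointPlace [IsAlgClosed L] {ζ₀ : L} (hζ₀ : IsPrimitiveRoot ζ₀ p) (hsep : f.Separable)
    {a b : L} (hb : b ^ p = (f.map (algebraMap K L)).eval a) (g : L[X]) :
    aeval (genX K L p f) g ∈ (pointPlace K L p f a b).toValuationSubring :=
  aeval_genX_mem_of_restrict_eq_placeXSubC (restrict_pointPlace hζ₀ hsep hb) g

/-- `y ∈ O_{Q_{(a,b)}}`. [folklore] -/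
theorem genY_mem_pointPlace [IsAlgClosed L] {ζ₀ : L} (hζ₀ : IsPrimitiveRoot ζ₀ p) (hsep : f.Separable)
    {a b : L} (hb : b ^ p = (f.map (algebraMap K L)).eval a) :
    genY K L p f ∈ (pointPlace K L p f a b).toValuationSubring := by
  have hlt := valuation_pointPlace_genY_sub_lt_one hζ₀ hsep hb
  have hmem : genY K L p f - algebraMap L _ b ∈ (pointPlace K L p f a b).toValuationSubring :=
    ((pointPlace K L p f a b).toValuationSubring.valuation_le_one_iff _).1 hlt.le
  have : genY K L p f = (genY K L p f - algebraMap L _ b) + algebraMap L _ b := by ring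
  rw [this]
  exact add_mem hmem ((pointPlace K L p f a b).algebraMap_mem b)

/-- `x ≡ a (mod Q_{(a,b)})`. [folklore] -/
theorem valuation_pointPlace_genX_sub_lt_one [IsAlgClosed L] {ζ₀ : L} (hζ₀ : IsPrimitiveRoot ζ₀ p) (hsep : f.Separable)
    {a b : L} (hb : b ^ p = (f.map (algebraMap K L)).eval a) :
    (pointPlace K L p f a b).valuation (genX K L p f - algebraMap L _ a) < 1 :=
  ((pointPlace K L p f a b).valuation_lt_one_iff_ord_pos (genX_sub_algebraMap_ne_zero K L p f a)).2
    (ord_pos_of_restrict_eq_placeXSubC (restrict_pointPlace hζ₀ hsep hb))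

/-! ### Galois and deck actions on the places of points -/

section Galois

variable {G : Type w} [Group G] [MulSemiringAction G L] [SMulCommClass G K L]

omit [Fact (Irreducible (superellipticPoly K L p f))] hp in
/-- `(σ b)^p = f(σ a)` for `b^p = f(a)` and `σ ∈ Aut(L/K)` (`f` has coefficients in `K`). [folklore] -/
theorem pow_eq_eval_smul (σ : G) {a b : L} (hb : b ^ p = (f.map (algebraMap K L)).eval a) :
    (σ • b) ^ p = (f.map (algebraMap K L)).eval (σ • a) := by
  rw [← smul_pow', hb, ← smul_map_algebraMap K L f σ, Polynomial.smul_eval_smul, smul_map_algebraMap]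

/-- **`σ Q_{(a,b)} = Q_{(σa, σb)}`**: automorphisms of `L/K` act on the places of points through the points.
[cite: Stichtenoth2009, Lemma 3.5.2] -/
theorem smul_pointPlace [IsAlgClosed L] {ζ₀ : L} (hζ₀ : IsPrimitiveRoot ζ₀ p) (hsep : f.Separable) (σ : G)
    {a b : L} (hb : b ^ p = (f.map (algebraMap K L)).eval a) :
    σ • pointPlace K L p f a b = pointPlace K L p f (σ • a) (σ • b) := by
  refine eq_pointPlace hζ₀ hsep (pow_eq_eval_smul σ hb)
    (restrict_smul_of_restrict_eq_placeXSubC σ (restrict_pointPlace hζ₀ hsep hb)) ?_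
  have h := (valuation_smul_smul_lt_one_iff σ (pointPlace K L p f a b) (genY K L p f - algebraMap L _ b)).2
    (valuation_pointPlace_genY_sub_lt_one hζ₀ hsep hb)
  rwa [smul_sub, smul_genY, smul_algebraMap_superelliptic] at h

end Galois

/-- **`ζ Q_{(a,b)} = Q_{(a, ζ⁻¹ b)}`** for the deck transformation `y ↦ ζ y`. [cite: Schaefer1998, §3] -/
theorem deck_smul_pointPlace [IsAlgClosed L] {ζ₀ : L} (hζ₀ : IsPrimitiveRoot ζ₀ p) (hsep : f.Separable)
    (ζ : CyclicCoverDeck L p) {a b : L} (hb : b ^ p = (f.map (algebraMap K L)).eval a) :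
    ζ • pointPlace K L p f a b = pointPlace K L p f a (ζ.val⁻¹ * b) := by
  have hb' : (ζ.val⁻¹ * b) ^ p = (f.map (algebraMap K L)).eval a := by
    rw [mul_pow, inv_pow, ζ.val_pow, inv_one, one_mul, hb]
  refine eq_pointPlace hζ₀ hsep hb' (by rw [restrict_deck_smul, restrict_pointPlace hζ₀ hsep hb]) ?_
  exact valuation_deck_smul_sub_lt_one deck_smul_genY (valuation_pointPlace_genY_sub_lt_one hζ₀ hsep hb) ζ

end SuperellipticFunctionField

end Literature.NumberTheory.GaloisRepresentations
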